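import Literature.AlgebraicGeometry.Motives.ZarhinHodgeGroupLieAlgebra
import Literature.AlgebraicGeometry.Motives.HodgeTensorMorphisms
import Literature.AlgebraicGeometry.Motives.HodgeStructureAbelianTypeDual
import Literature.AlgebraicGeometry.Motives.HodgeStructureAbelianTypeDirectSum
import Literature.AlgebraicGeometry.Motives.HodgeStructureQuotient
import Literature.AlgebraicGeometry.Motives.HodgeStructureK3Type
import HarnessLib

/-!
# The Lie algebra of the Hodge group of a direct summand and of a direct sum:
# `π 𝔥(H) ι ⊆ 𝔥(H₁)` for a retract `H₁ ⇄ H`, `𝔥(⊕_j H_j) ↪ Π_j 𝔥(H_j)`, `𝔥(H^{⊕ m}) ↪ 𝔥(H)`, `dim 𝔥(e^* H) = dim 𝔥(H)`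

Family `hodge`, layer `Literature/AlgebraicGeometry/Motives`.  Theorems only; no definition, no named fact.  Written for
the cell `pub-hodgecm2` (COR-CM), seat `b27` gen 35, count-neutral lane MT-RANK-FIVE-DIVISORS (the CONVERSE half: the
upper bound `dim Lie Hg(H¹(B^{a+1} × E^{b+1})) ≤ dim Lie Hg(H¹B) + dim Lie Hg(H¹E)`).

For a `ℚ`-Hodge structure `H` on a finite-dimensional `V`, `𝔥(H) = H.hodgeLie ⊆ End_ℚ(V)`
(`Motives/ZarhinHodgeGroupLieAlgebra`) is the annihilator, under the derivation action, of all Hodge tensors of all types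
`(p,p)` in all `T^{a,b} V` — the Lie algebra of the Hodge group.  Classically (Deligne, LNM 900, I §3; Moonen–Zarhin 1999
§3 first paragraph: «`Hg(X₁ × X₂) ⊆ Hg(X₁) × Hg(X₂)` … the projections are surjective») the Hodge group of a direct sum
embeds in the product of the Hodge groups of the summands, and the Hodge group of `X^m` is that of `X`.  This file proves
the LIE-ALGEBRA forms of these two inclusions from the tensor definition:

* §1 `map_piTensorDerivation_of_comp_eq`, `map_tensorDerivation_of_comp_eq` — NATURALITY of the derivation action: if
  `f ∘ Y = Y' ∘ f` on `W → W'` and `g ∘ Yᵀ = Y'ᵀ ∘ g` on `W^∨ → W'^∨`, then `(f^{⊗a} ⊗ g^{⊗b}) ∘ ρ(Y) = ρ(Y') ∘ (f^{⊗a} ⊗ g^{⊗b})`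
  on `T^{a,b}` (pure linear algebra over a field).
* §2 **`HodgeStructure.comp_mem_hodgeLie_of_retract`** — for morphisms of Hodge structures `ι : H₁ → H`, `π : H → H₁` with
  `π ∘ ι = id` and `X ∈ 𝔥(H)`: `π X ι ∈ 𝔥(H₁)`.  Proof: `T = ι^{⊗a} ⊗ (πᵀ)^{⊗b} : T^{a,b} H₁ → T^{a,b} H` is a morphism of Hodge
  structures (`Hom.tensorPowerMap`, `Hom.dualMap`, `Hom.tensorMap`) with retraction `π^{⊗a} ⊗ (ιᵀ)^{⊗b}`, hence maps Hodge
  tensors to Hodge tensors; `X` commutes with the Hodge endomorphism `ι π` (`commute_of_mem_hodgeLie`), which gives the two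
  intertwining identities `ι (π X ι) = X ι`, `πᵀ (π X ι)ᵀ = Xᵀ πᵀ`; so `T (ρ(π X ι) t) = ρ(X) (T t) = 0` for a Hodge tensor
  `t` of `H₁`, and `T` is injective.  Transport along an isomorphism: `finrank_hodgeLie_comapEquiv` (`dim 𝔥(e^* H) = dim 𝔥(H)`).
* §3 direct sums `⊕_j H_j = HodgeStructure.pi H`: the coordinate inclusions are morphisms (`single_map_pi_F_le`); the
  diagonal blocks `pr_j X in_j` of `X ∈ 𝔥(⊕ H_j)` lie in `𝔥(H_j)` (`proj_comp_single_mem_hodgeLie_pi`), the off-diagonal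
  blocks vanish (`proj_comp_single_eq_zero_of_mem_hodgeLie_pi`, since `X` commutes with the Hodge idempotents `in_j pr_j`),
  so `X ↦ (pr_j X in_j)_j` is injective: **`finrank_hodgeLie_pi_le_sum`** — `dim 𝔥(⊕_j H_j) ≤ Σ_j dim 𝔥(H_j)`; and for a
  CONSTANT family all diagonal blocks coincide (`X` commutes with the Hodge endomorphisms `in_i pr_j`):
  **`finrank_hodgeLie_pi_const_le`** — `dim 𝔥(H^{⊕ m}) ≤ dim 𝔥(H)`.

## References
* [Deligne1982HodgeCycles] P. Deligne, *Hodge cycles on abelian varieties*, LNM 900 (1982), I §3.1 and Prop. 3.4.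
  [cite: Deligne1982HodgeCycles, I §3.1 and Prop. 3.4]
* [MoonenZarhin1999LowDim] B. Moonen, Yu. Zarhin, Math. Ann. 315 (1999), §3 first paragraph [corpus: paper:arxiv-math_9901113 p. 6].
  [cite: MoonenZarhin1999LowDim, §3]
* [Huybrechts2016K3] D. Huybrechts, *Lectures on K3 Surfaces*, §3.3.3–3.3.4, Thm. 3.3.9. [cite: Huybrechts2016K3, §3.3.4 and Thm. 3.3.9]
* [DeligneHodgeII1971] P. Deligne, *Théorie de Hodge II*, 2.1 (direct sums of Hodge structures). [cite: DeligneHodgeII1971, 2.1]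
* A. Borel, *Linear Algebraic Groups*, 2nd ed. (1991), §3.8–3.9 (the Lie algebra of a stabiliser is the annihilator).
-/

noncomputable section

open scoped TensorProduct PiTensorProduct

namespace Literature.AlgebraicGeometry.Motives

/-! ### §1 Naturality of the derivation action along intertwining maps -/

section Naturality

universe uK uW uW'

variable {K : Type uK} [Field K] {W : Type uW} [AddCommGroup W] [Module K W] {W' : Type uW'} [AddCommGroup W']
  [Module K W']

/-- **Naturality of the Leibniz action on tensor powers**: if `f ∘ Y = Y' ∘ f` then
`f^{⊗a} ∘ D_a(Y) = D_a(Y') ∘ f^{⊗a}` (checked on pure tensors: both sides are `Σ_k ⋯ ⊗ f(Y v_k) ⊗ ⋯`).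
[cite: Deligne1982HodgeCycles, I §3.1] -/
theorem map_piTensorDerivation_of_comp_eq (f : W →ₗ[K] W') {Y : Module.End K W} {Y' : Module.End K W'}
    (h : f ∘ₗ Y = Y' ∘ₗ f) (a : ℕ) (x : ⨂[K]^a W) :
    PiTensorProduct.map (fun _ : Fin a => f) (piTensorDerivation a Y x) =
      piTensorDerivation a Y' (PiTensorProduct.map (fun _ : Fin a => f) x) := by
  induction x using PiTensorProduct.induction_on with
  | smul_tprod r v =>
    simp only [map_smul]
    rw [piTensorDerivation_tprod, PiTensorProduct.map_tprod, piTensorDerivation_tprod, map_sum]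
    congr 1
    refine Finset.sum_congr rfl fun k _ => ?_
    rw [PiTensorProduct.map_tprod]
    congr 1
    funext i
    rw [Function.apply_update (fun _ => f) v k (Y (v k)) i]
    have hfY : f (Y (v k)) = Y' (f (v k)) := by
      rw [← LinearMap.comp_apply, h, LinearMap.comp_apply]
    rw [hfY]
  | add x y hx hy => rw [map_add, map_add, hx, hy, map_add, map_add]

/-- **Naturality of the derivation action on `T^{a,b}`**: if `f ∘ Y = Y' ∘ f` on `W → W'` and `g ∘ Yᵀ = Y'ᵀ ∘ g` on
`W^∨ → W'^∨`, then `(f^{⊗a} ⊗ g^{⊗b}) ∘ ρ_{a,b}(Y) = ρ_{a,b}(Y') ∘ (f^{⊗a} ⊗ g^{⊗b})`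
(`ρ_{a,b}(Y) = D_a(Y) ⊗ 1 - 1 ⊗ D_b(Yᵀ)`). [cite: Deligne1982HodgeCycles, I §3.1] -/
theorem map_tensorDerivation_of_comp_eq (f : W →ₗ[K] W') (g : Module.Dual K W →ₗ[K] Module.Dual K W')
    {Y : Module.End K W} {Y' : Module.End K W'} (hf : f ∘ₗ Y = Y' ∘ₗ f)
    (hg : g ∘ₗ (Y.dualMap : Module.End K (Module.Dual K W)) = (Y'.dualMap : Module.End K (Module.Dual K W')) ∘ₗ g)
    (a b : ℕ) (t : hodgeTensorSpaceOver K W a b) :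
    TensorProduct.map (PiTensorProduct.map fun _ : Fin a => f) (PiTensorProduct.map fun _ : Fin b => g)
        (tensorDerivation a b Y t) =
      tensorDerivation a b Y' (TensorProduct.map (PiTensorProduct.map fun _ : Fin a => f)
        (PiTensorProduct.map fun _ : Fin b => g) t) := by
  induction t using TensorProduct.induction_on with
  | zero => rw [map_zero, map_zero, map_zero]
  | tmul x ξ =>
    rw [tensorDerivation_apply, tensorDerivation_apply, LinearMap.sub_apply, LinearMap.rTensor_tmul,
      LinearMap.lTensor_tmul, map_sub, TensorProduct.map_tmul, TensorProduct.map_tmul, TensorProduct.map_tmul,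
      LinearMap.sub_apply, LinearMap.rTensor_tmul, LinearMap.lTensor_tmul,
      map_piTensorDerivation_of_comp_eq f hf, map_piTensorDerivation_of_comp_eq g hg]
  | add x y hx hy => rw [map_add, map_add, hx, hy, map_add, map_add]

end Naturality

namespace HodgeStructure

/-! ### §2 The Lie algebra of the Hodge group of a retract (direct summand) -/

section Retract

universe u

variable {V₁ : Type u} [AddCommGroup V₁] [Module ℚ V₁] [Module.Finite ℚ V₁]
  {V : Type u} [AddCommGroup V] [Module ℚ V] [Module.Finite ℚ V] [HodgeTensorFacts.{u, u}] {n : ℤ}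
  {H₁ : HodgeStructure V₁ n} {H : HodgeStructure V n}

/-- **`π 𝔥(H) ι ⊆ 𝔥(H₁)` for a retract `ι : H₁ → H`, `π : H → H₁`, `π ι = id` of Hodge structures**: if `X ∈ Lie Hg(H)`
then `π X ι ∈ Lie Hg(H₁)`.  The transport `T = ι^{⊗a} ⊗ (πᵀ)^{⊗b}` is an injective morphism `T^{a,b}H₁ → T^{a,b}H` of Hodge
structures, so `T t` is a Hodge tensor when `t` is; `X` commutes with the Hodge endomorphism `ι π`, whence
`ι (π X ι) = X ι` and `πᵀ (π X ι)ᵀ = Xᵀ πᵀ`, and by naturality `T (ρ(π X ι) t) = ρ(X)(T t) = 0`.  (Lie-algebra form of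
`Hg(H) → Hg(H₁)`, `g ↦ π g ι`, for a direct summand; Deligne I Prop. 3.4, Moonen–Zarhin §3.)
[cite: Deligne1982HodgeCycles, I §3.1 and Prop. 3.4] [cite: MoonenZarhin1999LowDim, §3] [cite: Huybrechts2016K3, Thm. 3.3.9] -/
theorem comp_mem_hodgeLie_of_retract (ι : Hom H₁ H) (π : Hom H H₁)
    (hπι : ∀ v, π.toLinearMap (ι.toLinearMap v) = v) {X : Module.End ℚ V} (hX : X ∈ H.hodgeLie) :
    π.toLinearMap ∘ₗ X ∘ₗ ι.toLinearMap ∈ H₁.hodgeLie := by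
  have hX' := (mem_hodgeLie_iff H X).1 hX
  rw [mem_hodgeLie_iff]
  intro a b p hab t ht
  -- the transport morphisms `T = ι^{⊗a} ⊗ (πᵀ)^{⊗b}` and `R = π^{⊗a} ⊗ (ιᵀ)^{⊗b}`, `R T = id`
  let T : Hom (H₁.tensorSpace a b) (H.tensorSpace a b) :=
    Hom.congrF (Hom.tensorMap (ι.tensorPowerMap a) (π.dualMap.tensorPowerMap b)) (fun _ => rfl) (fun _ => rfl)
  let R : Hom (H.tensorSpace a b) (H₁.tensorSpace a b) :=
    Hom.congrF (Hom.tensorMap (π.tensorPowerMap a) (ι.dualMap.tensorPowerMap b)) (fun _ => rfl) (fun _ => rfl)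
  have hRT : ∀ s, R.toLinearMap (T.toLinearMap s) = s := fun s =>
    Hom.tensorMap_retract (ι.tensorPowerMap a) (π.tensorPowerMap a) (Hom.tensorPowerMap_retract ι π hπι a)
      (π.dualMap.tensorPowerMap b) (ι.dualMap.tensorPowerMap b)
      (Hom.tensorPowerMap_retract π.dualMap ι.dualMap (Hom.dualMap_retract ι π hπι) b) s
  -- `T t` is a Hodge tensor of `H`, killed by `ρ(X)`
  have hTt : T.toLinearMap t ∈ (H.tensorSpace a b).hodgeClasses p := Hom.map_hodgeClasses_le T p ⟨t, ht, rfl⟩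
  have h0 : tensorDerivation a b X (T.toLinearMap t) = 0 := hX' a b p hab _ hTt
  -- `X` commutes with the Hodge endomorphism `e = ι π`
  have he : ι.toLinearMap ∘ₗ π.toLinearMap ∈ H.endAlg := Hom.toLinearMap_mem_endAlg (ι.comp π)
  have hXe : X * (ι.toLinearMap ∘ₗ π.toLinearMap) = (ι.toLinearMap ∘ₗ π.toLinearMap) * X :=
    commute_of_mem_hodgeLie H hX ⟨_, he⟩
  have hπιc : π.toLinearMap ∘ₗ ι.toLinearMap = LinearMap.id := LinearMap.ext hπι
  -- the two intertwining identities
  have hf : ι.toLinearMap ∘ₗ (π.toLinearMap ∘ₗ X ∘ₗ ι.toLinearMap) = X ∘ₗ ι.toLinearMap := by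
    refine LinearMap.ext fun v => ?_
    have h3 := LinearMap.congr_fun hXe (ι.toLinearMap v)
    simp only [Module.End.mul_apply, LinearMap.comp_apply] at h3
    rw [hπι] at h3
    simp only [LinearMap.comp_apply]
    exact h3.symm
  have hg : π.dualMap.toLinearMap ∘ₗ ((π.toLinearMap ∘ₗ X ∘ₗ ι.toLinearMap).dualMap :
        Module.End ℚ (Module.Dual ℚ V₁)) =
      (X.dualMap : Module.End ℚ (Module.Dual ℚ V)) ∘ₗ π.dualMap.toLinearMap := by
    rw [Hom.dualMap_toLinearMap]
    refine LinearMap.ext fun φ => LinearMap.ext fun v => ?_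
    change φ (π.toLinearMap (X (ι.toLinearMap (π.toLinearMap v)))) = φ (π.toLinearMap (X v))
    have h2 : π.toLinearMap (X (ι.toLinearMap (π.toLinearMap v))) = π.toLinearMap (X v) := by
      have h3 := LinearMap.congr_fun hXe v
      simp only [Module.End.mul_apply, LinearMap.comp_apply] at h3
      rw [h3, ← LinearMap.comp_apply (f := π.toLinearMap) (g := ι.toLinearMap), hπιc, LinearMap.id_apply]
    rw [h2]
  -- naturality and injectivity of `T`
  have hnat := map_tensorDerivation_of_comp_eq ι.toLinearMap π.dualMap.toLinearMap hf hg a b t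
  have hT : T.toLinearMap = TensorProduct.map (PiTensorProduct.map fun _ : Fin a => ι.toLinearMap)
      (PiTensorProduct.map fun _ : Fin b => π.dualMap.toLinearMap) := rfl
  rw [← hT, h0] at hnat
  rw [← hRT (tensorDerivation a b (π.toLinearMap ∘ₗ X ∘ₗ ι.toLinearMap) t), hnat, map_zero]

/-- **The restriction map `𝔥(H) → 𝔥(H₁)`, `X ↦ π X ι`, of a retract** as a `ℚ`-linear map into `𝔥(H₁)` (corestriction of
`X ↦ π X ι`). [cite: Deligne1982HodgeCycles, I Prop. 3.4] -/
theorem exists_linearMap_hodgeLie_of_retract (ι : Hom H₁ H) (π : Hom H H₁)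
    (hπι : ∀ v, π.toLinearMap (ι.toLinearMap v) = v) :
    ∃ Φ : H.hodgeLie →ₗ[ℚ] H₁.hodgeLie, ∀ X : H.hodgeLie,
      (Φ X : Module.End ℚ V₁) = π.toLinearMap ∘ₗ (X : Module.End ℚ V) ∘ₗ ι.toLinearMap :=
  ⟨{ toFun := fun X => ⟨_, comp_mem_hodgeLie_of_retract ι π hπι X.2⟩
     map_add' := fun X Y => Subtype.ext (by
       simp only [Submodule.coe_add, LinearMap.comp_add, LinearMap.add_comp])
     map_smul' := fun c X => Subtype.ext (by
       simp only [Submodule.coe_smul, LinearMap.comp_smul, LinearMap.smul_comp, RingHom.id_apply]) },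
    fun _ => rfl⟩

end Retract

/-! ### §2b Transport along an isomorphism: `dim 𝔥(e^* H) = dim 𝔥(H)` -/

section Transport

universe u

variable {V : Type u} [AddCommGroup V] [Module ℚ V] [Module.Finite ℚ V]
  {W : Type u} [AddCommGroup W] [Module ℚ W] [Module.Finite ℚ W] [HodgeTensorFacts.{u, u}] {n : ℤ}

/-- **`e⁻¹ 𝔥(H) e ⊆ 𝔥(e^* H)`** for a linear equivalence `e : V ≃ W` (the transported structure `e^* H = H.comapEquiv e`
is isomorphic to `H` through `e`, `Hom.ofComapBaseChange` / `Hom.symmOfComapBaseChange`; a retract both ways).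
[cite: Deligne1982HodgeCycles, I §3.1 and Prop. 3.4] -/
theorem conj_symm_mem_hodgeLie_comapEquiv (H : HodgeStructure W n) (e : V ≃ₗ[ℚ] W) {X : Module.End ℚ W}
    (hX : X ∈ H.hodgeLie) : e.symm.toLinearMap ∘ₗ X ∘ₗ e.toLinearMap ∈ (H.comapEquiv e).hodgeLie :=
  comp_mem_hodgeLie_of_retract (H₁ := H.comapEquiv e) (H := H)
    (Hom.ofComapBaseChange e fun _ => rfl) (Hom.symmOfComapBaseChange e fun _ => rfl) e.symm_apply_apply hX

/-- **`e 𝔥(e^* H) e⁻¹ ⊆ 𝔥(H)`** for a linear equivalence `e : V ≃ W`. [cite: Deligne1982HodgeCycles, I §3.1 and Prop. 3.4] -/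
theorem conj_mem_hodgeLie_of_mem_hodgeLie_comapEquiv (H : HodgeStructure W n) (e : V ≃ₗ[ℚ] W)
    {Y : Module.End ℚ V} (hY : Y ∈ (H.comapEquiv e).hodgeLie) :
    e.toLinearMap ∘ₗ Y ∘ₗ e.symm.toLinearMap ∈ H.hodgeLie :=
  comp_mem_hodgeLie_of_retract (H₁ := H) (H := H.comapEquiv e)
    (Hom.symmOfComapBaseChange e fun _ => rfl) (Hom.ofComapBaseChange e fun _ => rfl) e.apply_symm_apply hY

/-- **The dimension of the Lie algebra of the Hodge group is an invariant of the isomorphism class of a Hodge structure**: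
`dim_ℚ 𝔥(e^* H) = dim_ℚ 𝔥(H)` (conjugation by `e` is a linear bijection `𝔥(e^* H) ≅ 𝔥(H)`; companion of the tree's
`HodgeStructure.mtRank_comapEquiv`). [cite: Deligne1982HodgeCycles, I §3.1 and Prop. 3.4] -/
theorem finrank_hodgeLie_comapEquiv (H : HodgeStructure W n) (e : V ≃ₗ[ℚ] W) :
    Module.finrank ℚ (H.comapEquiv e).hodgeLie = Module.finrank ℚ H.hodgeLie := by
  have h1 : (H.comapEquiv e).hodgeLie.map (e.conj : Module.End ℚ V ≃ₗ[ℚ] Module.End ℚ W).toLinearMap ≤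
      H.hodgeLie := by
    rintro _ ⟨Y, hY, rfl⟩
    exact conj_mem_hodgeLie_of_mem_hodgeLie_comapEquiv H e hY
  have h2 : H.hodgeLie.map (e.symm.conj : Module.End ℚ W ≃ₗ[ℚ] Module.End ℚ V).toLinearMap ≤
      (H.comapEquiv e).hodgeLie := by
    rintro _ ⟨X, hX, rfl⟩
    have h := conj_symm_mem_hodgeLie_comapEquiv H e hX
    rw [LinearEquiv.coe_coe, LinearEquiv.conj_apply, LinearEquiv.symm_symm, LinearMap.comp_assoc]
    exact h
  refine le_antisymm ?_ ?_
  · have := Submodule.finrank_mono h1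
    rwa [LinearEquiv.finrank_map_eq] at this
  · have := Submodule.finrank_mono h2
    rwa [LinearEquiv.finrank_map_eq] at this

end Transport

/-! ### §3 Direct sums: `𝔥(⊕_j H_j) ↪ Π_j 𝔥(H_j)`, and `𝔥(H^{⊕ m}) ↪ 𝔥(H)` -/

section Pi

universe u

variable {ι : Type} [Fintype ι] [DecidableEq ι] {W : ι → Type u} [∀ j, AddCommGroup (W j)] [∀ j, Module ℚ (W j)]
  [∀ j, Module.Finite ℚ (W j)] [HodgeTensorFacts.{u, u}] {n : ℤ} (H : ∀ j, HodgeStructure (W j) n)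

omit [∀ j, Module.Finite ℚ (W j)] [HodgeTensorFacts.{u, u}] in
/-- **The coordinate inclusion `H_j → ⊕_i H_i` is a morphism of Hodge structures** (the filtration of `HodgeStructure.pi`
is componentwise, `mem_pi_F_iff`; the components of `in_j x` are `x` and `0`). [cite: DeligneHodgeII1971, 2.1] -/
theorem single_map_pi_F_le (j : ι) (p : ℤ) :
    ((H j).F p).map ((LinearMap.single ℚ W j).baseChange ℂ) ≤ (pi H).F p := by
  rintro _ ⟨x, hx, rfl⟩
  rw [mem_pi_F_iff]
  intro i
  rw [← proj_baseChange_apply, ← LinearMap.comp_apply, ← LinearMap.baseChange_comp]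
  by_cases hij : i = j
  · subst hij
    rw [LinearMap.proj_comp_single_same, LinearMap.baseChange_id, LinearMap.id_apply]
    exact hx
  · rw [LinearMap.proj_comp_single_ne ℚ W i j hij, LinearMap.baseChange_zero, LinearMap.zero_apply]
    exact Submodule.zero_mem _

/-- **The diagonal blocks of `X ∈ 𝔥(⊕_j H_j)` lie in `𝔥(H_j)`**: `pr_j X in_j ∈ 𝔥(H_j)` (§2 for the retract
`in_j : H_j ⇄ ⊕ H_i : pr_j`). [cite: Deligne1982HodgeCycles, I Prop. 3.4] [cite: MoonenZarhin1999LowDim, §3] -/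
theorem proj_comp_single_mem_hodgeLie_pi (j : ι) {X : Module.End ℚ (∀ i, W i)} (hX : X ∈ (pi H).hodgeLie) :
    LinearMap.proj j ∘ₗ X ∘ₗ LinearMap.single ℚ W j ∈ (H j).hodgeLie :=
  comp_mem_hodgeLie_of_retract (H₁ := H j) (H := pi H)
    ({ toLinearMap := LinearMap.single ℚ W j, map_F_le := single_map_pi_F_le H j } : Hom (H j) (pi H))
    (Hom.piProj H j) (fun v => by simp) hX

/-- **`X ∈ 𝔥(⊕_j H_j)` commutes with the Hodge endomorphisms `in_i ∘ φ ∘ pr_j`** for every morphism `φ : H_j → H_i`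
(`commute_of_mem_hodgeLie`; `in_i φ pr_j` is the composite morphism `⊕ H → H_j → H_i → ⊕ H`).
[cite: Huybrechts2016K3, Thm. 3.3.9 (proof, p. 67)] -/
theorem commute_single_comp_proj_of_mem_hodgeLie_pi {i j : ι} (φ : Hom (H j) (H i)) {X : Module.End ℚ (∀ k, W k)}
    (hX : X ∈ (pi H).hodgeLie) :
    X * (LinearMap.single ℚ W i ∘ₗ φ.toLinearMap ∘ₗ LinearMap.proj j) =
      (LinearMap.single ℚ W i ∘ₗ φ.toLinearMap ∘ₗ LinearMap.proj j) * X := by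
  have hmem : LinearMap.single ℚ W i ∘ₗ φ.toLinearMap ∘ₗ LinearMap.proj j ∈ (pi H).endAlg :=
    Hom.toLinearMap_mem_endAlg
      ((({ toLinearMap := LinearMap.single ℚ W i, map_F_le := single_map_pi_F_le H i } : Hom (H i) (pi H)).comp
        φ).comp (Hom.piProj H j))
  exact commute_of_mem_hodgeLie _ hX ⟨_, hmem⟩

/-- **The off-diagonal blocks of `X ∈ 𝔥(⊕_j H_j)` vanish**: `pr_i X in_j = 0` for `i ≠ j` (`X` commutes with the Hodge
idempotent `in_j pr_j`, and `pr_i in_j = 0`). [cite: Deligne1982HodgeCycles, I Prop. 3.4] [cite: MoonenZarhin1999LowDim, §3] -/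
theorem proj_comp_single_eq_zero_of_mem_hodgeLie_pi {i j : ι} (hij : i ≠ j) {X : Module.End ℚ (∀ k, W k)}
    (hX : X ∈ (pi H).hodgeLie) : LinearMap.proj i ∘ₗ X ∘ₗ LinearMap.single ℚ W j = 0 := by
  have hc := commute_single_comp_proj_of_mem_hodgeLie_pi H (i := j) (j := j) (Hom.id (H j)) hX
  have hid : (Hom.id (H j)).toLinearMap = LinearMap.id := rfl
  rw [hid, LinearMap.id_comp] at hc
  refine LinearMap.ext fun w => ?_
  have h := LinearMap.congr_fun hc (Pi.single j w)
  simp only [Module.End.mul_apply, LinearMap.comp_apply, LinearMap.proj_apply, Pi.single_eq_same,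
    LinearMap.coe_single] at h
  rw [LinearMap.comp_apply, LinearMap.comp_apply, LinearMap.coe_single, LinearMap.proj_apply, h, LinearMap.zero_apply,
    Pi.single_eq_of_ne hij]

/-- **`X ∈ 𝔥(⊕_j H_j)` is determined by its diagonal blocks**: if `pr_j X in_j = 0` for all `j` then `X = 0`
(`X = Σ_{i,j} in_i (pr_i X in_j) pr_j` and the off-diagonal blocks vanish). [cite: Deligne1982HodgeCycles, I Prop. 3.4] -/
theorem eq_zero_of_forall_proj_comp_single_eq_zero {X : Module.End ℚ (∀ k, W k)} (hX : X ∈ (pi H).hodgeLie)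
    (h : ∀ j, LinearMap.proj j ∘ₗ X ∘ₗ LinearMap.single ℚ W j = 0) : X = 0 := by
  have hblock : ∀ i j, LinearMap.proj i ∘ₗ X ∘ₗ LinearMap.single ℚ W j = 0 := fun i j => by
    by_cases hij : i = j
    · subst hij; exact h i
    · exact proj_comp_single_eq_zero_of_mem_hodgeLie_pi H hij hX
  refine LinearMap.ext fun v => funext fun i => ?_
  rw [LinearMap.zero_apply, Pi.zero_apply, ← Finset.univ_sum_single v, map_sum, Finset.sum_apply]
  refine Finset.sum_eq_zero fun j _ => ?_
  have hij := LinearMap.congr_fun (hblock i j) (v j)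
  simpa using hij

/-- **`dim 𝔥(⊕_j H_j) ≤ Σ_j dim 𝔥(H_j)`**: the block map `X ↦ (pr_j X in_j)_j : 𝔥(⊕_j H_j) → Π_j 𝔥(H_j)` is an injective
linear map (Lie-algebra form of `Hg(X₁ × X₂) ⊆ Hg(X₁) × Hg(X₂)`, Moonen–Zarhin §3).
[cite: MoonenZarhin1999LowDim, §3] [cite: Deligne1982HodgeCycles, I Prop. 3.4] -/
theorem finrank_hodgeLie_pi_le_sum :
    Module.finrank ℚ (pi H).hodgeLie ≤ ∑ j, Module.finrank ℚ (H j).hodgeLie := by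
  classical
  let Φ : (pi H).hodgeLie →ₗ[ℚ] (∀ j, (H j).hodgeLie) :=
    { toFun := fun X j => ⟨_, proj_comp_single_mem_hodgeLie_pi H j X.2⟩
      map_add' := fun X Y => funext fun j => Subtype.ext (by
        simp only [Submodule.coe_add, LinearMap.comp_add, LinearMap.add_comp, Pi.add_apply])
      map_smul' := fun c X => funext fun j => Subtype.ext (by
        simp only [Submodule.coe_smul, LinearMap.comp_smul, LinearMap.smul_comp, RingHom.id_apply, Pi.smul_apply]) }
  have hΦ : Function.Injective Φ := by
    rw [injective_iff_map_eq_zero]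
    intro X hX0
    refine Subtype.ext (eq_zero_of_forall_proj_comp_single_eq_zero H X.2 fun j => ?_)
    have h := congrArg (fun F => ((F j : (H j).hodgeLie) : Module.End ℚ (W j))) hX0
    exact h
  calc Module.finrank ℚ (pi H).hodgeLie ≤ Module.finrank ℚ (∀ j, (H j).hodgeLie) :=
        LinearMap.finrank_le_finrank_of_injective hΦ
    _ = ∑ j, Module.finrank ℚ (H j).hodgeLie := Module.finrank_pi_fintype ℚ

end Pi

section PiConst

universe u

variable {ι : Type} [Fintype ι] [DecidableEq ι] {V : Type u} [AddCommGroup V] [Module ℚ V] [Module.Finite ℚ V]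
  [HodgeTensorFacts.{u, u}] {n : ℤ} (H : HodgeStructure V n)

/-- **In `𝔥(H^{⊕ m})` all diagonal blocks coincide**: `pr_i X in_i = pr_j X in_j` for `X ∈ 𝔥(⊕_{ι} H)` (`X` commutes with
the Hodge endomorphism `in_i pr_j` of the constant family). [cite: Deligne1982HodgeCycles, I Prop. 3.4] [cite: MoonenZarhin1999LowDim, §3] -/
theorem proj_comp_single_eq_of_mem_hodgeLie_pi_const {X : Module.End ℚ (ι → V)}
    (hX : X ∈ (pi fun _ : ι => H).hodgeLie) (i j : ι) :
    LinearMap.proj i ∘ₗ X ∘ₗ LinearMap.single ℚ (fun _ : ι => V) i =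
      LinearMap.proj j ∘ₗ X ∘ₗ LinearMap.single ℚ (fun _ : ι => V) j := by
  have hc := commute_single_comp_proj_of_mem_hodgeLie_pi (fun _ : ι => H) (i := i) (j := j) (Hom.id H) hX
  have hid : (Hom.id H).toLinearMap = LinearMap.id := rfl
  rw [hid, LinearMap.id_comp] at hc
  refine LinearMap.ext fun w => ?_
  have h := LinearMap.congr_fun hc (Pi.single j w)
  simp only [Module.End.mul_apply, LinearMap.comp_apply, LinearMap.proj_apply, Pi.single_eq_same,
    LinearMap.coe_single] at h
  -- `h : X (single i w) = single i ((X (single j w)) j)`; read off the `i`-th component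
  have h' := congrArg (fun f : ι → V => f i) h
  simp only [Pi.single_eq_same] at h'
  rw [LinearMap.comp_apply, LinearMap.comp_apply, LinearMap.coe_single, LinearMap.proj_apply, h',
    LinearMap.comp_apply, LinearMap.comp_apply, LinearMap.coe_single, LinearMap.proj_apply]

/-- **`dim 𝔥(H^{⊕ m}) ≤ dim 𝔥(H)`**: one diagonal block determines `X ∈ 𝔥(⊕_{ι} H)` (all diagonal blocks coincide and the
off-diagonal ones vanish), so `X ↦ pr_j X in_j : 𝔥(⊕_ι H) → 𝔥(H)` is injective (Lie-algebra form of `Hg(Xᵐ) = Hg(X)`).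
[cite: MoonenZarhin1999LowDim, §3] [cite: Deligne1982HodgeCycles, I Prop. 3.4] -/
theorem finrank_hodgeLie_pi_const_le :
    Module.finrank ℚ (pi fun _ : ι => H).hodgeLie ≤ Module.finrank ℚ H.hodgeLie := by
  classical
  rcases isEmpty_or_nonempty ι with hι | ⟨⟨j₀⟩⟩
  · -- the zero space: every endomorphism of `ι → V` is `0`
    haveI : Subsingleton (ι → V) := ⟨fun f g => funext fun i => (hι.false i).elim⟩
    haveI : Subsingleton (Module.End ℚ (ι → V)) := ⟨fun f g => LinearMap.ext fun x => Subsingleton.elim _ _⟩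
    have h0 : Module.finrank ℚ (pi fun _ : ι => H).hodgeLie = 0 :=
      le_antisymm ((Submodule.finrank_le _).trans (Module.finrank_zero_of_subsingleton).le) (Nat.zero_le _)
    rw [h0]; exact Nat.zero_le _
  · let Φ : (pi fun _ : ι => H).hodgeLie →ₗ[ℚ] H.hodgeLie :=
      { toFun := fun X => ⟨_, proj_comp_single_mem_hodgeLie_pi (fun _ : ι => H) j₀ X.2⟩
        map_add' := fun X Y => Subtype.ext (by
          simp only [Submodule.coe_add, LinearMap.comp_add, LinearMap.add_comp])
        map_smul' := fun c X => Subtype.ext (by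
          simp only [Submodule.coe_smul, LinearMap.comp_smul, LinearMap.smul_comp, RingHom.id_apply]) }
    have hΦ : Function.Injective Φ := by
      rw [injective_iff_map_eq_zero]
      intro X hX0
      have h0 : LinearMap.proj j₀ ∘ₗ (X : Module.End ℚ (ι → V)) ∘ₗ LinearMap.single ℚ (fun _ : ι => V) j₀ = 0 :=
        congrArg (fun Y : H.hodgeLie => (Y : Module.End ℚ V)) hX0
      refine Subtype.ext (eq_zero_of_forall_proj_comp_single_eq_zero (fun _ : ι => H) X.2 fun j => ?_)
      rw [proj_comp_single_eq_of_mem_hodgeLie_pi_const H X.2 j j₀, h0]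
    exact LinearMap.finrank_le_finrank_of_injective hΦ

end PiConst

end HodgeStructure

end Literature.AlgebraicGeometry.Motives

end
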